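import Summits.HodgeConjecture.CorCM.GaloisDicyclicImprimitiveTypes
import Summits.HodgeConjecture.CorCM.FaceCensusInducedTypes
import Literature.NumberTheory.ComplexMultiplication.CMGaloisSubfield
import HarnessLib

/-!
# A left stabiliser of a CM type read on a model of the Galois group makes the type INDUCED from a fixed field

COR-CM (cell `pub-hodgecm2`), binder seat b04 (gen 21), count-neutral claim DICYCLIC-ALLTYPES, part I (general
Galois CM fields; the field-theoretic step of the ALL-TYPES programme of `A7-JUNCTION.md`, gen 20).  KERNEL ONLY:
theorems; no definition, no named fact, no `sorry`.  `HC_CM` is neither used nor claimed.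

SETTING (gens 16/20, `CorCM/GaloisRankCertificates`, `CorCM/GaloisRightTranslateRank`).  `K/ℚ` Galois CM,
`e : Gal(K/ℚ) ≃* G₀` a model of its Galois group, `φ₀` a base embedding, `σ_g = embOf φ₀ g = φ₀ ∘ g⁻¹`, and a CM
type `Φ` read on `G₀` as `S = {y | σ_{e⁻¹ y} ∈ Φ}`.  Gen 16 (`not_isPrimitive_of_leftStabiliser`) / gen 20 part XIII
(`not_isPrimitive_iff_exists_leftStabiliser`): `Φ` is IMPRIMITIVE iff `S` has a LEFT STABILISER `v ≠ 1`
(`v S = S`).  Here the left stabiliser is turned into the INPUT SHAPE of Shimura's theorem on abelian varieties of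
induced type (tree `EndFieldFullDegree.isStablyNondegenerate_of_isNondegenerate`, `isIsogenous_powSucc_varietyOfIdeal`:
`A ∼ B^{[K:K₀]}`): `Φ = inducedCMType (algebraMap K₀ K) Φ₀` for the fixed field `K₀ = K^H` of any subgroup `H` with
`e(H) ⊆ ⟨v⟩`.

* §1 `mem_iff_zpow_mul_mem`, `mem_iff_mul_mem_of_mem_zpowers` (a left stabiliser's cyclic group stabilises);
  `embOf_comp_coe` (`σ_g ∘ u = σ_{u⁻¹ g}`: precomposition with `u ∈ Gal(K/ℚ)` is LEFT multiplication on the model);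
  **`comp_mem_iff_of_leftStabiliser`** — `Φ ∘ u = Φ` for every `u` with `e u ∈ ⟨v⟩`.
* §2 **`exists_inducedCMType_fixedField_of_leftStabiliser`** — for every `H ≤ Gal(K/ℚ)` with `e(H) ⊆ ⟨v⟩`,
  `Φ = Φ₀^K` for a CM type `Φ₀` of `K^H` (seat b09's `FaceCensus.exists_inducedCMType_of_comp_stable` BY NAME;
  Streng Def. I.3.2); the instance `H = e⁻¹⟨v⟩` (`exists_inducedCMType_fixedField_comap_zpowers`) and the
  imprimitive form `exists_inducedCMType_of_not_isPrimitive_model`.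
* §3 **`isCMField_fixedField_of_not_mem`** — `K^H` is a CM field as soon as complex conjugation `c ∉ H`
  (`CMGaloisSubfield.isCMField_of_exists_conjGal_apply_ne`, Streng Lemma I.2.2 (d)); model form
  `isCMField_fixedField_of_forall_mem_zpowers` (`c₀ ∉ ⟨v⟩`), and `card_subgroup_dvd_of_forall_mem_zpowers`.

## References

* [Shimura1998] G. Shimura, *Abelian Varieties with Complex Multiplication and Modular Functions* (1998), §8.1
  (`σ_g`), §8.2 (types induced from a subfield; Prop. 26).
* [Streng2010] M. Streng, *Complex multiplication of abelian surfaces* (2010), Ch. I Def. 3.2, Lemma 2.2 (d).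
-/

noncomputable section

open NumberField

namespace Summit.HodgeConjecture.CorCM.GaloisRank

open Literature.NumberTheory.ComplexMultiplication
open Literature.AlgebraicGeometry.Motives (CMType)
open Literature.AlgebraicGeometry.Pohlmann1968

/-! ## §1 Left stabilisers and precomposition -/

section Stabiliser

variable {G₀ : Type*} [Group G₀]

/-- The powers of a left stabiliser are left stabilisers. [folklore] -/
theorem mem_iff_pow_mul_mem (S : Finset G₀) {v : G₀} (hv : ∀ w : G₀, w ∈ S ↔ v * w ∈ S) (m : ℕ) (w : G₀) :
    w ∈ S ↔ v ^ m * w ∈ S := by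
  induction m generalizing w with
  | zero => rw [pow_zero, one_mul]
  | succ m ih => rw [pow_succ, mul_assoc, ← ih, ← hv]

/-- The integer powers of a left stabiliser are left stabilisers. [folklore] -/
theorem mem_iff_zpow_mul_mem (S : Finset G₀) {v : G₀} (hv : ∀ w : G₀, w ∈ S ↔ v * w ∈ S) (m : ℤ) (w : G₀) :
    w ∈ S ↔ v ^ m * w ∈ S := by
  rcases Int.eq_nat_or_neg m with ⟨k, rfl | rfl⟩
  · rw [zpow_natCast]
    exact mem_iff_pow_mul_mem S hv k w
  · rw [zpow_neg, zpow_natCast]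
    have h := mem_iff_pow_mul_mem S hv k ((v ^ k)⁻¹ * w)
    rw [mul_inv_cancel_left] at h
    exact h.symm

/-- Every element of the cyclic group `⟨v⟩` of a left stabiliser `v` is a left stabiliser. [folklore] -/
theorem mem_iff_mul_mem_of_mem_zpowers (S : Finset G₀) {v : G₀} (hv : ∀ w : G₀, w ∈ S ↔ v * w ∈ S) {u : G₀}
    (hu : u ∈ Subgroup.zpowers v) (w : G₀) : w ∈ S ↔ u * w ∈ S := by
  obtain ⟨m, rfl⟩ := Subgroup.mem_zpowers_iff.1 hu
  exact mem_iff_zpow_mul_mem S hv m w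

variable {K : Type} [Field K] [NumberField K]

/-- **Precomposition is left multiplication on the model**: `σ_g ∘ u = σ_{u⁻¹ g}` (`σ_g = φ₀ ∘ g⁻¹`).
[cite: Shimura1998, §8.1] -/
theorem embOf_comp_coe (φ₀ : K →+* ℂ) (g u : K ≃ₐ[ℚ] K) :
    (embOf φ₀ g).comp (u : K →+* K) = embOf φ₀ (u⁻¹ * g) := by
  refine RingHom.ext fun x => ?_
  rw [RingHom.comp_apply, embOf_apply, embOf_apply, RingHom.coe_coe]
  congr 1

/-- **A left stabiliser `v` of `S` makes `Φ` stable under precomposition with every `u ∈ Gal(K/ℚ)` such that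
`e u ∈ ⟨v⟩`**: `ψ ∘ u ∈ Φ ↔ ψ ∈ Φ`. [cite: Shimura1998, §8.1–§8.2] -/
theorem comp_mem_iff_of_leftStabiliser [Normal ℚ K] (e : (K ≃ₐ[ℚ] K) ≃* G₀) (Φ : CMType K) (φ₀ : K →+* ℂ)
    (S : Finset G₀) (hS : ∀ y : G₀, y ∈ S ↔ embOf φ₀ (e.symm y) ∈ Φ.1) {v : G₀}
    (hv : ∀ w : G₀, w ∈ S ↔ v * w ∈ S) {u : K ≃ₐ[ℚ] K} (hu : e u ∈ Subgroup.zpowers v) (ψ : K →+* ℂ) :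
    ψ.comp (u : K →+* K) ∈ Φ.1 ↔ ψ ∈ Φ.1 := by
  obtain ⟨g, rfl⟩ := (embOf_bijective φ₀).2 ψ
  rw [embOf_comp_coe]
  have h1 := hS (e (u⁻¹ * g))
  have h2 := hS (e g)
  rw [e.symm_apply_apply] at h1 h2
  rw [← h1, ← h2, map_mul, map_inv]
  exact (mem_iff_mul_mem_of_mem_zpowers S hv (Subgroup.inv_mem _ hu) (e g)).symm

end Stabiliser

/-! ## §2 The type is induced from the fixed field of `H`, `e(H) ⊆ ⟨v⟩` -/

section Induced

variable {G₀ : Type*} [Group G₀]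
variable {K : Type} [Field K] [NumberField K] [IsGalois ℚ K]

/-- **A left stabiliser makes the type induced from a fixed field.**  If `v` is a left stabiliser of the set `S`
of `Φ` on the model `e`, then for every subgroup `H ≤ Gal(K/ℚ)` with `e(H) ⊆ ⟨v⟩` there is a CM type `Φ₀` of the
fixed field `K^H` with `Φ = inducedCMType (algebraMap K^H K) Φ₀` (Streng Def. I.3.2: `Φ = {φ | φ|_{K^H} ∈ Φ₀}`).
[cite: Shimura1998, §8.2 (types induced from a subfield)] [cite: Streng2010, Ch. I Def. 3.2] -/
theorem exists_inducedCMType_fixedField_of_leftStabiliser (e : (K ≃ₐ[ℚ] K) ≃* G₀) (Φ : CMType K)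
    (φ₀ : K →+* ℂ) (S : Finset G₀) (hS : ∀ y : G₀, y ∈ S ↔ embOf φ₀ (e.symm y) ∈ Φ.1) {v : G₀}
    (hv : ∀ w : G₀, w ∈ S ↔ v * w ∈ S) (H : Subgroup (K ≃ₐ[ℚ] K))
    (hH : ∀ u ∈ H, e u ∈ Subgroup.zpowers v) :
    ∃ Φ₀ : CMType (IntermediateField.fixedField H),
      inducedCMType (algebraMap (IntermediateField.fixedField H) K) Φ₀ = Φ :=
  FaceCensus.exists_inducedCMType_of_comp_stable H Φ fun u hu ψ =>
    comp_mem_iff_of_leftStabiliser e Φ φ₀ S hS hv (hH u hu) ψ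

/-- The instance `H = e⁻¹⟨v⟩`: `Φ` is induced from the fixed field of the cyclic group of the left stabiliser.
[cite: Shimura1998, §8.2 (types induced from a subfield)] [cite: Streng2010, Ch. I Def. 3.2] -/
theorem exists_inducedCMType_fixedField_comap_zpowers (e : (K ≃ₐ[ℚ] K) ≃* G₀) (Φ : CMType K)
    (φ₀ : K →+* ℂ) (S : Finset G₀) (hS : ∀ y : G₀, y ∈ S ↔ embOf φ₀ (e.symm y) ∈ Φ.1) {v : G₀}
    (hv : ∀ w : G₀, w ∈ S ↔ v * w ∈ S) :
    ∃ Φ₀ : CMType (IntermediateField.fixedField ((Subgroup.zpowers v).comap e.toMonoidHom)),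
      inducedCMType (algebraMap (IntermediateField.fixedField ((Subgroup.zpowers v).comap e.toMonoidHom)) K) Φ₀
        = Φ :=
  exists_inducedCMType_fixedField_of_leftStabiliser e Φ φ₀ S hS hv _ fun _ hu => Subgroup.mem_comap.1 hu

/-- **Imprimitive types are induced from a fixed field** (model form of Shimura §8.2 Prop. 26): an imprimitive
`Φ` has a left stabiliser `v ≠ 1` on the model (gen 20 part XIII), and is induced from `K^{e⁻¹⟨v⟩}`.
[cite: Shimura1998, §8.2 Prop. 26] -/
theorem exists_inducedCMType_of_not_isPrimitive_model (e : (K ≃ₐ[ℚ] K) ≃* G₀) (Φ : CMType K)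
    (φ₀ : K →+* ℂ) (S : Finset G₀) (hS : ∀ y : G₀, y ∈ S ↔ embOf φ₀ (e.symm y) ∈ Φ.1)
    (h : ¬ IsPrimitive (ℂ ≃+* ℂ) Φ.1 φ₀) :
    ∃ v : G₀, v ≠ 1 ∧ (∀ w : G₀, w ∈ S ↔ v * w ∈ S) ∧
      ∃ Φ₀ : CMType (IntermediateField.fixedField ((Subgroup.zpowers v).comap e.toMonoidHom)),
        inducedCMType (algebraMap (IntermediateField.fixedField ((Subgroup.zpowers v).comap e.toMonoidHom)) K) Φ₀
          = Φ := by
  obtain ⟨v, hv1, hv⟩ := exists_leftStabiliser_of_not_isPrimitive e Φ φ₀ S hS h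
  exact ⟨v, hv1, hv, exists_inducedCMType_fixedField_comap_zpowers e Φ φ₀ S hS hv⟩

end Induced

/-! ## §3 The fixed field is a CM field when complex conjugation is not in `H` -/

section CMField

variable {G₀ : Type*} [Group G₀]
variable {K : Type} [Field K] [NumberField K] [IsCMField K] [IsGalois ℚ K]

/-- **`K^H` is a CM field when `c ∉ H`**: `H = Gal(K/K^H)` (Artin), so `c` moves some element of `K^H`, and a
subfield of a Galois CM field moved by `c` is CM (Streng Lemma I.2.2 (d), the tree's
`isCMField_of_exists_conjGal_apply_ne`). [cite: Streng2010, Ch. I Lemma 2.2 (d)] -/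
theorem isCMField_fixedField_of_not_mem (H : Subgroup (K ≃ₐ[ℚ] K))
    (hc : (IsCMField.complexConj K).restrictScalars ℚ ∉ H) : IsCMField (IntermediateField.fixedField H) := by
  refine isCMField_of_exists_conjGal_apply_ne _ ?_
  by_contra hne
  push Not at hne
  apply hc
  have h : (conjGal : K ≃ₐ[ℚ] K) ∈ H := by
    rw [← IntermediateField.fixingSubgroup_fixedField H, IntermediateField.mem_fixingSubgroup_iff]
    exact hne
  exact h

/-- Model form: if `e(H) ⊆ ⟨v⟩` and `c₀ = e(c) ∉ ⟨v⟩`, then `K^H` is a CM field. [cite: Streng2010, Ch. I Lemma 2.2 (d)] -/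
theorem isCMField_fixedField_of_forall_mem_zpowers (e : (K ≃ₐ[ℚ] K) ≃* G₀) {c₀ : G₀}
    (hc : e ((IsCMField.complexConj K).restrictScalars ℚ) = c₀) {v : G₀} (hv : c₀ ∉ Subgroup.zpowers v)
    (H : Subgroup (K ≃ₐ[ℚ] K)) (hH : ∀ u ∈ H, e u ∈ Subgroup.zpowers v) :
    IsCMField (IntermediateField.fixedField H) :=
  isCMField_fixedField_of_not_mem H fun h => hv (hc ▸ hH _ h)

omit [IsCMField K] [IsGalois ℚ K] in
/-- **Degree bookkeeping**: `[K^H : ℚ] · |H| = [K : ℚ]`, and `|H|` divides the order of `v` when `e(H) ⊆ ⟨v⟩`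
(`e` is injective, `|⟨v⟩| = orderOf v`). [folklore] -/
theorem card_subgroup_dvd_of_forall_mem_zpowers [Fintype G₀] (e : (K ≃ₐ[ℚ] K) ≃* G₀) {v : G₀}
    (H : Subgroup (K ≃ₐ[ℚ] K)) (hH : ∀ u ∈ H, e u ∈ Subgroup.zpowers v) :
    Nat.card H ∣ orderOf v ∧
      Module.finrank ℚ (IntermediateField.fixedField H) * Nat.card H = Module.finrank ℚ K := by
  refine ⟨?_, FaceCensus.finrank_fixedField_mul_card H⟩
  have hle : H.map e.toMonoidHom ≤ Subgroup.zpowers v := by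
    rintro _ ⟨u, hu, rfl⟩
    exact hH u hu
  have h1 : Nat.card H = Nat.card (H.map e.toMonoidHom) :=
    (Subgroup.card_map_of_injective (K := H) (f := e.toMonoidHom) (fun a b h => e.injective h)).symm
  rw [h1, ← Nat.card_zpowers v]
  exact Subgroup.card_dvd_of_le hle

end CMField

end Summit.HodgeConjecture.CorCM.GaloisRank

end
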